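import Summits.BirchSwinnertonDyer.BirchSwinnertonDyer.Theorems.ResidualThetaTransportAtTwoResidualSignedLambdaLowerCMAtTwoThetaKummerKernel
import Summits.BirchSwinnertonDyer.BirchSwinnertonDyer.Theorems.SchneiderFreeAdditiveX3PoitouTateUnramifiedOrthogonalAllLevels
import Summits.BirchSwinnertonDyer.BirchSwinnertonDyer.Theorems.SchneiderFreeAdditiveX3PoitouTateReciprocitySumHolds
import Literature.NumberTheory.GaloisCohomology.PoitouTateSelmerStructuresCanonicalLift
import HarnessLib

/-!
# The LEVELWISE Poitou–Tate call of the deep half at `2`, STRICT at `S₀` (item 6 `stub_deepHalfAtTwoStrict` of the line `onepair`)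

Route `ResidualThetaTransportAtTwo` (RTT), crux RSL_g `ResidualSignedLambdaLowerCMAtTwo` (stmt-BirchSwinnertonDyer-22608); seat
`prover-bsd-wall-tp2-p2x` g18 (`--supports 22608 --as helper`, closes nothing). THEOREMS ONLY (no definition, no named fact, no instance
declaration, no `sorry`). STUB-PLAN `stub_cmLambdaLower` rev 19 §3 item 6 (S4₂): «ONE `SelmerComplement` / Poitou–Tate call per `(n,k)` over
`K = ℚ` on `ρc := Maps(Γ_ℚ ⧸ Γ_n, A_ρ[p^k])`» — the `ρ`-twin of the TP2 (E) socket `SignedLowerOffTwo.PTDeep.levelwisePoitouTate_of_transfer`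
(`…PTDeepSelmerSocket.lean`) with the two changes item 6 dictates: the Selmer structure is STRICT (`⊥`) at `S₀` (so the produced class DIES at
`S₀` and the dual structure is RELAXED there — no `S₀`-hypothesis in the orthogonality input), and the Kummer side at `v ∣ p` is the
Θ-transported Kummer map `thetaLayerKummer` of tuples of layer points (any subgroup `Pn`; `Pn = ⊤` for S4₂).

`exists_admissible_strict_valueCond_of_levelwise_orthogonal`: from `hzker` («`z mod p^k` kills the tuples of `Pn` with trivial Θ-Kummer
class» — a THEOREM for every `Pn`, `ThetaKummerKernel.toZModPow_eq_zero_of_thetaLayerKummer_eq_zero`) and `hT` = LEVELWISE ORTHOGONALITY (the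
output of GLUE-67 of card k3-g13 = (T)_ρ ∘ item 6's Λ-adic hypothesis ∘ readback): «for every `b ∈ H¹(Γ_n, A_ρ[p^k])` and `Q₀ ∈ Pn` with
[unr] `Sh b` unramified at the finite `w ∉ S₀`, `w ∤ p`, [inf] `loc_∞ (Sh b) = 0`, [kum] `loc_n b = thetaLayerKummer Q₀`: `(z Q₀) mod p^k = 0`»,
conclude `∃ c ∈ H¹(Γ_n, A_ρ[p^k])` with [adm] `res_{Γ_n ⊓ I_𝔓} c = 0` for `𝔓 ∣ w ∉ S₀ ∪ {w ∋ p}` (currency of `…CofreeAdmissible`), [strict]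
`loc_w (Sh c) = 0` for `w ∈ S₀`, [val] `⟨loc_n c, thetaLayerKummer Q⟩_{n,p^k} = (z Q) mod p^k` for `Q ∈ Pn` (the value condition of
`…DeepHalfValueTransfer`) — a point of the solution set `Sol n k` of `DeepHalfTransfer.exists_iwasawaH1_locd₂_eq_of_levelwise_from`;
`…_top`: `Pn = ⊤`, `hzker` discharged, `(Q, hQ)` tuple currency.

Proof (TP2's, line by line): Selmer structures on `ρc` — `𝓖` = `⊤` at `∞` and over `p`, `⊥` at `S₀`, unramified elsewhere; `𝓕 := 𝓖[v ↦ C^⊥]`,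
`C := T_v(Sh_v(thetaLayerKummer(Pn)))` (`CoindShapiroOfFun.exists_injective_dualTransport`), `χ_z : C → ℤ/p^k`, `T_v(Sh θK Q) ↦ (z Q) mod p^k`.
Orthogonality of `χ_z` to `loc_v H¹_{𝓕*}(ℚ, ρc^D)`: `y = H¹(Ψ)(Sh b)` (`existsUnique_shapiroLift_coindTateDual_eq`); the dual conditions give
[unr] (`unramifiedOrthogonal_of_isPerfect_allLevels` + `ShapiroTransport.localization_mem_unramifiedSubgroup_of_coindTateDual`), [inf]
(`eq_zero_of_forall_localTatePairingZMod_canonical_inl_eq_zero` + `ShapiroTransport.localization_eq_zero_of_localization_coindTateDual_eq_zero`),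
nothing at `S₀` (`⊥^⊥ = ⊤`), [kum] (`localTatePairingZMod_canonical_localization_coindTateDual_shapiroLift`,
`eq_zero_of_forall_invAt_cupProduct_pull_eq_zero`); then the one-place lift `LocalInvariants.exists_selmer_canonical_localTatePairing_eq_of_subgroup`
over `SchneiderFreeAdditiveX3.PoitouTateReduction.poitouTate_selmerStructure_duality_real_holds ℚ`; `c := Sh⁻¹ X`
(`ShapiroTransport.admissible_of_forall_localization_shapiroLift_mem`, `cohomologyMap_coindFinPull_localization_shapiroLift`, `layerPairingH1Of_apply`).

HONEST FRAMING: `--supports` theorems, CONDITIONAL on `hT`; nothing about any count or `L`-value; BSD is not proved by any of this; RSL_g (22608)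
and the K3 crux (20308) stay OPEN. References: [MilneADT2006] I Cor. 2.3, Thm. 2.6, 2.13 (a), 4.10 (b); [Howard2004HeegnerKolyvagin] Thm. 2.1.11;
[NeukirchSchmidtWingberg2008] I §6 (1.6.4); [Kobayashi2003] (7.17)–(7.21), (8.23); [Greenberg1989] §1 p. 98; [Kato2004Asterisque] §13.8.
-/

set_option autoImplicit false
-- the Theorems namespace of this sub repeats the summit name by design (D-0017 nested layout)
set_option linter.dupNamespace false

noncomputable section

open scoped Classical

namespace Summit.BirchSwinnertonDyer.BirchSwinnertonDyer.Theorems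

namespace ThetaTransport.DeepHalfLevelwise

open CategoryTheory Field NumberField IsDedekindDomain WeierstrassCurve
  Literature.NumberTheory.EllipticCurves Literature.NumberTheory.EllipticCurves.CyclotomicLayer
  Literature.NumberTheory.EllipticCurves.Kobayashi2003 Literature.NumberTheory.EllipticCurves.Sprung2012
  Literature.NumberTheory.EllipticCurves.GreenbergSelmer
  Literature.NumberTheory.GaloisRepresentations Literature.NumberTheory.GaloisRepresentations.DiscreteGaloisModule
  Literature.NumberTheory.GaloisCohomology ZpExtension
open SignedLowerOffTwo.PTDeep (eq_zero_of_forall_localTatePairingZMod_canonical_eq_zero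
  eq_zero_of_forall_localTatePairingZMod_canonical_inl_eq_zero)
open ThetaTransport.CoindShapiroOfFun (cohomologyMap_coindFinPull_localization_shapiroLift
  localTatePairingZMod_canonical_localization_coindTateDual_shapiroLift existsUnique_shapiroLift_coindTateDual_eq
  exists_injective_dualTransport eq_zero_of_forall_invAt_cupProduct_pull_eq_zero)
open ThetaTransport.ShapiroTransport (admissible_of_forall_localization_shapiroLift_mem
  isUnramifiedAt_coind_cofreeTorsionGaloisModule_layerSubgroup localization_eq_zero_of_localization_coindTateDual_eq_zero
  localization_mem_unramifiedSubgroup_of_coindTateDual)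


open ThetaTransport.ThetaKummerKernel (toZModPow_eq_zero_of_thetaLayerKummer_eq_zero)

section Levelwise

variable {p : ℕ} [Fact p.Prime] (S : Set (PadicAlgCl p)) {d : ℕ} (ρ : FramedGaloisRep ℚ ↥(padicCoeffIntegers S) d)
  (W : WeierstrassCurve ℚ) [W.IsElliptic] {r : ℕ} (k : ℕ)
  (ePk : ∀ k : ℕ, ↥(AddSubgroup.torsionBy (Cofree ρ ↥(padicCoeffField S)) ((p ^ k : ℕ) : ℤ)) →
    ↥(AddSubgroup.torsionBy (Cofree ρ ↥(padicCoeffField S)) ((p ^ k : ℕ) : ℤ)) → AlgebraicClosure ℚ)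
  (hμPk : ∀ k a b, ePk k a b ^ (p ^ k) = 1)
  (hadd₁Pk : ∀ k a₁ a₂ b, ePk k (a₁ + a₂) b = ePk k a₁ b * ePk k a₂ b)
  (hadd₂Pk : ∀ k a b₁ b₂, ePk k a (b₁ + b₂) = ePk k a b₁ * ePk k a b₂)
  (hgalPk : ∀ k (σ : absoluteGaloisGroup ℚ) (a b : ↥(AddSubgroup.torsionBy (Cofree ρ ↥(padicCoeffField S)) ((p ^ k : ℕ) : ℤ))),
    σ • ePk k a b = ePk k (cofreeTorsionGaloisModule S ρ _ σ a) (cofreeTorsionGaloisModule S ρ _ σ b))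
  (hnondeg : ∀ T, (∀ a, ePk k a T = 1) → T = 0)
  (Θ : Cofree ρ ↥(padicCoeffField S) ≃+ (Fin r → ↥(W.geomPrimaryTorsion p))) (κ : ZpExtension ℚ p)
  (v : HeightOneSpectrum (𝓞 ℚ))
  (hΘ : ∀ (δ : absoluteGaloisGroup (v.adicCompletion ℚ)) (m : Cofree ρ ↥(padicCoeffField S)) (i : Fin r),
    Θ (resGalOfEmb (closureEmb (K := ℚ) (v.adicCompletion ℚ)) δ • m) i =
      resGalOfEmb (closureEmb (K := ℚ) (v.adicCompletion ℚ)) δ • Θ m i)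
  (hκ : κ.IsCyclotomic) (hv : (p : 𝓞 ℚ) ∈ v.asIdeal)
  (S₀ : Finset (HeightOneSpectrum (𝓞 ℚ))) (hS₀ : ∀ w ∈ S₀, (p : 𝓞 ℚ) ∉ w.asIdeal)
  (hρ : ∀ w : HeightOneSpectrum (𝓞 ℚ), w ∉ S₀ → (p : 𝓞 ℚ) ∉ w.asIdeal → ρ.IsUnramifiedAt w)
  (n : ℕ) [Fintype (absoluteGaloisGroup ℚ ⧸ κ.layerSubgroup n)]
  {s : absoluteGaloisGroup ℚ ⧸ κ.layerSubgroup n → absoluteGaloisGroup ℚ}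
  (hs : ∀ x : absoluteGaloisGroup ℚ ⧸ κ.layerSubgroup n, (s x : absoluteGaloisGroup ℚ ⧸ κ.layerSubgroup n) = x)
  (hs1 : s ((1 : absoluteGaloisGroup ℚ) : absoluteGaloisGroup ℚ ⧸ κ.layerSubgroup n) = 1)

include hnondeg hκ hv hS₀ hρ in
-- one `(n, k)`-level assembly in a single declaration (as TP2's socket, there 400000): the `ρ`-coefficient module `A_ρ[p^k]` (torsion subtype of
-- the quotient `Cofree ρ`) makes every `whnf`/`isDefEq` on the Selmer-structure types an order of magnitude dearer (measured: > 1 600 000)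
set_option maxHeartbeats 3200000 in
/-- **Levelwise Poitou–Tate, strict at `S₀`, Θ-Kummer values at `v ∣ p`.** See the module docstring. For a subgroup `Pn` of layer-`n` tuples
and a functional `z` on tower tuples: if `z mod p^k` kills the tuples of `Pn` with trivial Θ-Kummer class (`hzker`) and kills every `Q₀ ∈ Pn`
that is the Θ-Kummer preimage of the layer localisation of a class `b` whose Shapiro lift is unramified outside `S₀ ∪ {p}` and trivial at `∞`
(`hT`, levelwise orthogonality), then some `c ∈ H¹(Γ_n, A_ρ[p^k])` is admissible outside `S₀ ∪ {w ∋ p}`, dies at every `w ∈ S₀` and pairs with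
the Θ-Kummer class of every `Q ∈ Pn` to `(z Q) mod p^k`. CONDITIONAL on `hT`/`hzker`; credit nothing.
[cite: MilneADT2006, Ch. I, Thm. 4.10(b), Cor. 2.3, Thm. 2.6, Thm. 2.13] [cite: Howard2004HeegnerKolyvagin, Thm. 2.1.11 (arXiv:1202.6340 p. 6)]
[cite: Kobayashi2003, (7.17)–(7.21), (8.23)] [cite: NeukirchSchmidtWingberg2008, I §6 Prop. (1.6.4)] -/
theorem exists_admissible_strict_valueCond_of_levelwise_orthogonal [CompactSpace (absoluteGaloisGroup ℚ)]
    [CompactSpace (absoluteGaloisGroup (v.adicCompletion ℚ))]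
    (Pn : AddSubgroup (Fin r → localLayerPointsOfEmb κ (closureEmb (K := ℚ) (v.adicCompletion ℚ)) W n))
    (z : (Fin r → localTowerPointsOfEmb κ (closureEmb (K := ℚ) (v.adicCompletion ℚ)) W) →+ ℤ_[p])
    (hzker : ∀ Q ∈ Pn, thetaLayerKummer S ρ k W Θ κ v hΘ n Q = 0 →
      PadicInt.toZModPow k (z (fun i => ⟨(Q i : localPoints W (v.adicCompletion ℚ)),
        localLayerPointsOfEmb_le_localTowerPointsOfEmb κ _ W n (Q i).2⟩)) = 0)
    (hT : ∀ (b : H1 (cofreeTorsionGaloisModule S ρ ((p ^ k : ℕ) : ℤ)) (κ.layerSubgroup n)) (Q₀ : _) (_ : Q₀ ∈ Pn),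
      (∀ w : HeightOneSpectrum (𝓞 ℚ), w ∉ S₀ → (p : 𝓞 ℚ) ∉ w.asIdeal →
        galoisCohomology.localization
            ((cofreeTorsionGaloisModule S ρ ((p ^ k : ℕ) : ℤ)).coind (κ.layerSubgroup n) (κ.isOpen_layerSubgroup n)) (Sum.inr w) 1
            (shapiroLift (cofreeTorsionGaloisModule S ρ ((p ^ k : ℕ) : ℤ)).toTopRep (κ.layerSubgroup n) (κ.isOpen_layerSubgroup n)
              hs hs1 b) ∈
          unramifiedSubgroup (GaloisRep.toLocal w
            ((cofreeTorsionGaloisModule S ρ ((p ^ k : ℕ) : ℤ)).coind (κ.layerSubgroup n) (κ.isOpen_layerSubgroup n))) 1) →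
      (∀ w : InfinitePlace ℚ,
        galoisCohomology.localization
            ((cofreeTorsionGaloisModule S ρ ((p ^ k : ℕ) : ℤ)).coind (κ.layerSubgroup n) (κ.isOpen_layerSubgroup n)) (Sum.inl w) 1
            (shapiroLift (cofreeTorsionGaloisModule S ρ ((p ^ k : ℕ) : ℤ)).toTopRep (κ.layerSubgroup n) (κ.isOpen_layerSubgroup n)
              hs hs1 b) = 0) →
      layerLocOf (cofreeTorsionGaloisModule S ρ ((p ^ k : ℕ) : ℤ)) κ v n b = thetaLayerKummer S ρ k W Θ κ v hΘ n Q₀ →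
      PadicInt.toZModPow k (z (fun i => ⟨(Q₀ i : localPoints W (v.adicCompletion ℚ)),
        localLayerPointsOfEmb_le_localTowerPointsOfEmb κ _ W n (Q₀ i).2⟩)) = 0) :
    ∃ c : H1 (cofreeTorsionGaloisModule S ρ ((p ^ k : ℕ) : ℤ)) (κ.layerSubgroup n),
      (∀ w : HeightOneSpectrum (𝓞 ℚ), w ∉ ((↑S₀ : Set (HeightOneSpectrum (𝓞 ℚ))) ∪ {u | (p : 𝓞 ℚ) ∈ u.asIdeal}) →
        ∀ 𝔓 ∈ w.primesAbove,
          resLe (cofreeTorsionGaloisModule S ρ ((p ^ k : ℕ) : ℤ)).toTopRep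
            (inf_le_left : κ.layerSubgroup n ⊓ 𝔓.inertia (absoluteGaloisGroup ℚ) ≤ κ.layerSubgroup n) 1 c = 0) ∧
      (∀ w ∈ S₀,
        galoisCohomology.localization
            ((cofreeTorsionGaloisModule S ρ ((p ^ k : ℕ) : ℤ)).coind (κ.layerSubgroup n) (κ.isOpen_layerSubgroup n)) (Sum.inr w) 1
            (shapiroLift (cofreeTorsionGaloisModule S ρ ((p ^ k : ℕ) : ℤ)).toTopRep (κ.layerSubgroup n) (κ.isOpen_layerSubgroup n)
              hs hs1 c) = 0) ∧
      ∀ Q ∈ Pn,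
        layerPairingH1Of (cofreeTorsionGaloisModule S ρ ((p ^ k : ℕ) : ℤ)) (p ^ k) (ePk k) (hμPk k) (hadd₁Pk k) (hadd₂Pk k) (hgalPk k)
            κ v n (layerLocOf (cofreeTorsionGaloisModule S ρ ((p ^ k : ℕ) : ℤ)) κ v n c)
            (thetaLayerKummer S ρ k W Θ κ v hΘ n Q) =
          PadicInt.toZModPow k (z (fun i => ⟨(Q i : localPoints W (v.adicCompletion ℚ)),
            localLayerPointsOfEmb_le_localTowerPointsOfEmb κ _ W n (Q i).2⟩)) := by
  /- ### Level data: `N = p^k`, the module `(cofreeTorsionGaloisModule S ρ ((p ^ k : ℕ) : ℤ)) = A_ρ[p^k]`, the coind module `ρc`, finiteness -/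
  haveI : NeZero (p ^ k) := ⟨pow_ne_zero k (Fact.out : p.Prime).ne_zero⟩
  haveI : Finite ↥(AddSubgroup.torsionBy (Cofree ρ ↥(padicCoeffField S)) ((p ^ k : ℕ) : ℤ)) :=
    finite_cofreeTorsionBy_of_theta ρ p k W Θ
  let ι := closureEmb (K := ℚ) (v.adicCompletion ℚ)
  have hN : ∀ m : ↥(AddSubgroup.torsionBy (Cofree ρ ↥(padicCoeffField S)) ((p ^ k : ℕ) : ℤ)), (p ^ k) • m = 0 :=
    fun m => AddSubgroup.torsionBy.nsmul m
  have hM : ∀ m : absoluteGaloisGroup ℚ ⧸ κ.layerSubgroup n → ↥(AddSubgroup.torsionBy (Cofree ρ ↥(padicCoeffField S)) ((p ^ k : ℕ) : ℤ)),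
      (p ^ k) • m = 0 := fun φ => funext fun y => hN (φ y)
  obtain ⟨Tv, hTinj, hTpair⟩ := exists_injective_dualTransport (cofreeTorsionGaloisModule S ρ ((p ^ k : ℕ) : ℤ)) (p ^ k) (ePk k) (hμPk k) (hadd₁Pk k) (hadd₂Pk k) (hgalPk k)
    κ v hκ hv hnondeg hN n
  /- ### The classes `c_Q = T_v (Sh_v (θK Q))`, the subgroup `C` and the character `χ_z` -/
  let fE : Pn →+ galoisCohomology
      ((((cofreeTorsionGaloisModule S ρ ((p ^ k : ℕ) : ℤ)).coind (κ.layerSubgroup n) (κ.isOpen_layerSubgroup n)).tateDual (p ^ k)).toLocal (Sum.inr v)) 1 :=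
    (Tv.comp ((layerShapiroOf (cofreeTorsionGaloisModule S ρ ((p ^ k : ℕ) : ℤ)) κ v n).toAddMonoidHom.comp (thetaLayerKummer S ρ k W Θ κ v hΘ n))).comp Pn.subtype
  let C := fE.range
  let χ₀ : Pn →+ ZMod (p ^ k) :=
    (PadicInt.toZModPow k).toAddMonoidHom.comp
      (z.comp ((AddMonoidHom.pi fun i => (AddSubgroup.inclusion (localLayerPointsOfEmb_le_localTowerPointsOfEmb κ ι W n)).comp
        (Pi.evalAddMonoidHom (fun _ : Fin r => ↥(localLayerPointsOfEmb κ ι W n)) i)).comp Pn.subtype))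
  have hχ₀ : ∀ Q : Pn, χ₀ Q = PadicInt.toZModPow k (z (fun i => ⟨((Q : Fin r → localLayerPointsOfEmb κ ι W n) i :
      localPoints W (v.adicCompletion ℚ)), localLayerPointsOfEmb_le_localTowerPointsOfEmb κ _ W n
        ((Q : Fin r → localLayerPointsOfEmb κ ι W n) i).2⟩)) := fun Q => rfl
  -- `χ₀` kills the kernel of `fE` (`T_v`, `Sh_v` injective; then `hzker`)
  have hker : ∀ Q : Pn, fE Q = 0 → χ₀ Q = 0 := by
    intro Q hQ
    have h1 : layerShapiroOf (cofreeTorsionGaloisModule S ρ ((p ^ k : ℕ) : ℤ)) κ v n (thetaLayerKummer S ρ k W Θ κ v hΘ n (Q : Fin r → localLayerPointsOfEmb κ ι W n)) = 0 :=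
      hTinj (by rw [map_zero]; exact hQ)
    have h2 : thetaLayerKummer S ρ k W Θ κ v hΘ n (Q : Fin r → localLayerPointsOfEmb κ ι W n) = 0 :=
      shapiroLift_injective _ _ _ _ _ (by rw [map_zero]; exact h1)
    rw [hχ₀]
    exact hzker _ Q.2 h2
  have hker' : fE.ker ≤ χ₀.ker := fun Q hQ => (AddMonoidHom.mem_ker).mpr (hker Q ((AddMonoidHom.mem_ker).mp hQ))
  let eqv : Pn ⧸ fE.ker ≃+ fE.range := QuotientAddGroup.quotientKerEquivRange fE
  let χ : C →+ ZMod (p ^ k) := (QuotientAddGroup.lift fE.ker χ₀ hker').comp eqv.symm.toAddMonoidHom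
  have hχval : ∀ Q : Pn, χ ⟨fE Q, ⟨Q, rfl⟩⟩ = χ₀ Q := by
    intro Q
    have heq : eqv (QuotientAddGroup.mk Q) = ⟨fE Q, ⟨Q, rfl⟩⟩ := rfl
    change QuotientAddGroup.lift fE.ker χ₀ hker' (eqv.symm ⟨fE Q, ⟨Q, rfl⟩⟩) = χ₀ Q
    rw [← heq, AddEquiv.symm_apply_apply, QuotientAddGroup.lift_mk]
  /- ### The finite set `S = {∞} ∪ {w ∋ p} ∪ S₀` and the Selmer structures `𝓕 ≤ 𝓖` on `ρc` -/
  have hSfin : ((↑S₀ : Set (HeightOneSpectrum (𝓞 ℚ))) ∪ {u : HeightOneSpectrum (𝓞 ℚ) | (p : 𝓞 ℚ) ∈ u.asIdeal}).Finite := by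
    refine Set.Finite.union S₀.finite_toSet ?_
    have hpne : (p : 𝓞 ℚ) ≠ 0 := by exact_mod_cast (Fact.out : p.Prime).ne_zero
    have hne : Ideal.span {(p : 𝓞 ℚ)} ≠ ⊥ := fun h ↦ hpne (Ideal.span_singleton_eq_bot.mp h)
    refine (Ideal.finite_factors hne).subset fun w hw ↦ ?_
    simp only [Set.mem_setOf_eq] at hw ⊢
    exact Ideal.dvd_iff_le.mpr ((Ideal.span_singleton_le_iff_mem _).mpr hw)
  let Sset : Set (HeightOneSpectrum (𝓞 ℚ)) := (↑S₀ : Set (HeightOneSpectrum (𝓞 ℚ))) ∪ {u | (p : 𝓞 ℚ) ∈ u.asIdeal}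
  let Sfin : Finset (Place ℚ) := (Finset.univ : Finset (InfinitePlace ℚ)).image Sum.inl ∪ hSfin.toFinset.image Sum.inr
  have hSinl : ∀ w : InfinitePlace ℚ, (Sum.inl w : Place ℚ) ∈ Sfin := fun w =>
    Finset.mem_union_left _ (Finset.mem_image_of_mem _ (Finset.mem_univ w))
  have hSinr : ∀ w : HeightOneSpectrum (𝓞 ℚ), (Sum.inr w : Place ℚ) ∈ Sfin ↔ w ∈ Sset := by
    intro w
    constructor
    · intro h
      rcases Finset.mem_union.mp h with h | h
      · obtain ⟨w', -, hw'⟩ := Finset.mem_image.mp h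
        exact absurd hw' Sum.inl_ne_inr
      · obtain ⟨w', hw', heq⟩ := Finset.mem_image.mp h
        rw [← Sum.inr_injective heq]
        exact hSfin.mem_toFinset.mp hw'
    · exact fun h => Finset.mem_union_right _ (Finset.mem_image_of_mem _ (hSfin.mem_toFinset.mpr h))
  have hvS : v ∈ Sset := Set.mem_union_right _ (hv : v ∈ {u : HeightOneSpectrum (𝓞 ℚ) | (p : 𝓞 ℚ) ∈ u.asIdeal})
  have hv₀ : (Sum.inr v : Place ℚ) ∈ Sfin := (hSinr v).mpr hvS
  have hnotS : ∀ u : HeightOneSpectrum (𝓞 ℚ), u ∉ Sset → u ∉ S₀ ∧ (p : 𝓞 ℚ) ∉ u.asIdeal := fun u hu =>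
    ⟨fun h => hu (Set.mem_union_left _ (Finset.mem_coe.mpr h)), fun h => hu (Set.mem_union_right _ h)⟩
  -- `𝓖`: everything at `∞` and over `p`, ZERO at `S₀`, unramified outside
  let 𝓖 : SelmerStructure ((cofreeTorsionGaloisModule S ρ ((p ^ k : ℕ) : ℤ)).coind (κ.layerSubgroup n) (κ.isOpen_layerSubgroup n)) :=
    fun w => match w with
      | Sum.inl _ => ⊤
      | Sum.inr u => if u ∈ Sset then (if (p : 𝓞 ℚ) ∈ u.asIdeal then ⊤ else ⊥) else
          unramifiedSubgroup (GaloisRep.toLocal u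
            ((cofreeTorsionGaloisModule S ρ ((p ^ k : ℕ) : ℤ)).coind (κ.layerSubgroup n) (κ.isOpen_layerSubgroup n))) 1
  have h𝓖inl : ∀ w : InfinitePlace ℚ, 𝓖 (Sum.inl w) = ⊤ := fun _ => rfl
  have h𝓖S : ∀ u ∈ Sset, 𝓖 (Sum.inr u) = (if (p : 𝓞 ℚ) ∈ u.asIdeal then ⊤ else ⊥) := fun u hu => if_pos hu
  have h𝓖p : ∀ u : HeightOneSpectrum (𝓞 ℚ), (p : 𝓞 ℚ) ∈ u.asIdeal → 𝓖 (Sum.inr u) = ⊤ := fun u hu =>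
    (h𝓖S u (Set.mem_union_right _ hu)).trans (if_pos hu)
  have h𝓖S₀ : ∀ u ∈ S₀, 𝓖 (Sum.inr u) = ⊥ := fun u hu =>
    (h𝓖S u (Set.mem_union_left _ (Finset.mem_coe.mpr hu))).trans (if_neg (hS₀ u hu))
  have h𝓖nS : ∀ u : HeightOneSpectrum (𝓞 ℚ), u ∉ Sset → 𝓖 (Sum.inr u) =
      unramifiedSubgroup (GaloisRep.toLocal u
        ((cofreeTorsionGaloisModule S ρ ((p ^ k : ℕ) : ℤ)).coind (κ.layerSubgroup n) (κ.isOpen_layerSubgroup n))) 1 :=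
    fun u hu => if_neg hu
  let Cperp : AddSubgroup (galoisCohomology
      (((cofreeTorsionGaloisModule S ρ ((p ^ k : ℕ) : ℤ)).coind (κ.layerSubgroup n) (κ.isOpen_layerSubgroup n)).toLocal (Sum.inr v)) 1) :=
    { carrier := {a | ∀ c ∈ C, localTatePairingZMod ((cofreeTorsionGaloisModule S ρ ((p ^ k : ℕ) : ℤ)).coind (κ.layerSubgroup n) (κ.isOpen_layerSubgroup n)) (p ^ k) (Sum.inr v)
          (LocalInvariants.canonical ℚ (p ^ k) (Sum.inr v)) a c = 0}
      zero_mem' := fun c _ => by simp only [map_zero, AddMonoidHom.zero_apply]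
      add_mem' := fun {a b} ha hb c hc => by simp only [map_add, AddMonoidHom.add_apply, ha c hc, hb c hc, add_zero]
      neg_mem' := fun {a} ha c hc => by simp only [map_neg, AddMonoidHom.neg_apply, ha c hc, neg_zero] }
  let 𝓕 : SelmerStructure ((cofreeTorsionGaloisModule S ρ ((p ^ k : ℕ) : ℤ)).coind (κ.layerSubgroup n) (κ.isOpen_layerSubgroup n)) := Function.update 𝓖 (Sum.inr v) Cperp
  have h𝓕v : 𝓕 (Sum.inr v) = Cperp := Function.update_self _ _ _
  have h𝓕ne : ∀ w : Place ℚ, w ≠ Sum.inr v → 𝓕 w = 𝓖 w := fun w hw => Function.update_of_ne hw _ _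
  have h𝓖v : 𝓖 (Sum.inr v) = ⊤ := h𝓖p v hv
  have hle : 𝓕 ≤ 𝓖 := by
    intro w
    rcases eq_or_ne w (Sum.inr v) with rfl | hw
    · rw [h𝓕v, h𝓖v]; exact le_top
    · rw [h𝓕ne w hw]
  have h𝓖 : 𝓖.IsUnramifiedOutside Sfin :=
    ⟨hSinl, fun u hu => h𝓖nS u fun h => hu ((hSinr u).mpr h)⟩
  have h𝓕 : 𝓕.IsUnramifiedOutside Sfin := by
    refine ⟨hSinl, fun u hu => ?_⟩
    have hne : (Sum.inr u : Place ℚ) ≠ Sum.inr v := fun h => hu (by rw [h]; exact hv₀)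
    rw [h𝓕ne _ hne]
    exact h𝓖nS u fun h => hu ((hSinr u).mpr h)
  have hS' : ∀ u : HeightOneSpectrum (𝓞 ℚ), (Sum.inr u : Place ℚ) ∉ Sfin →
      ((p ^ k : ℕ) : 𝓞 ℚ) ∉ u.asIdeal ∧
        GaloisRep.IsUnramifiedAt u ((cofreeTorsionGaloisModule S ρ ((p ^ k : ℕ) : ℤ)).coind (κ.layerSubgroup n) (κ.isOpen_layerSubgroup n)) := by
    intro u hu
    obtain ⟨huS₀, hup⟩ := hnotS u fun h => hu ((hSinr u).mpr h)
    refine ⟨fun h => hup (u.isPrime.mem_of_pow_mem k ?_), ?_⟩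
    · rw [← Nat.cast_pow]; exact h
    · exact isUnramifiedAt_coind_cofreeTorsionGaloisModule_layerSubgroup S ρ κ _ n hup (hρ u huS₀ hup)
  have h𝓕v' : ∀ a, a ∈ 𝓕 (Sum.inr v) ↔ ∀ c ∈ C, localTatePairingZMod ((cofreeTorsionGaloisModule S ρ ((p ^ k : ℕ) : ℤ)).coind (κ.layerSubgroup n) (κ.isOpen_layerSubgroup n)) (p ^ k)
      (Sum.inr v) (LocalInvariants.canonical ℚ (p ^ k) (Sum.inr v)) a c = 0 := fun a => by rw [h𝓕v]; rfl
  /- ### Orthogonality: `χ_z` kills `loc_v y` for every `y ∈ H¹_{𝓕^*}(ℚ, ρc^D)` — the transports + `hT` -/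
  have hχ : ∀ y ∈ ((LocalInvariants.canonical ℚ (p ^ k)).dualSelmerStructure
        ((cofreeTorsionGaloisModule S ρ ((p ^ k : ℕ) : ℤ)).coind (κ.layerSubgroup n) (κ.isOpen_layerSubgroup n)) 𝓕).selmerGroup,
      ∀ hy : galoisCohomology.localization (((cofreeTorsionGaloisModule S ρ ((p ^ k : ℕ) : ℤ)).coind (κ.layerSubgroup n) (κ.isOpen_layerSubgroup n)).tateDual (p ^ k))
          (Sum.inr v) 1 y ∈ C,
        χ ⟨galoisCohomology.localization (((cofreeTorsionGaloisModule S ρ ((p ^ k : ℕ) : ℤ)).coind (κ.layerSubgroup n) (κ.isOpen_layerSubgroup n)).tateDual (p ^ k))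
          (Sum.inr v) 1 y, hy⟩ = 0 := by
    intro y hy hyC
    -- `y = H¹(Ψ) (Sh b)`
    obtain ⟨b, hb, -⟩ := existsUnique_shapiroLift_coindTateDual_eq (cofreeTorsionGaloisModule S ρ ((p ^ k : ℕ) : ℤ)) (p ^ k) (ePk k) (hμPk k) (hadd₁Pk k) (hadd₂Pk k) (hgalPk k)
      κ hnondeg hN n hs hs1 y
    subst hb
    -- `loc_v y = fE Q₀`, `Q₀ ∈ Pn`
    obtain ⟨Q₀, hQ₀⟩ := AddMonoidHom.mem_range.mp hyC
    have hyC' : (⟨_, hyC⟩ : C) = ⟨fE Q₀, ⟨Q₀, rfl⟩⟩ := Subtype.ext hQ₀.symm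
    rw [hyC', hχval, hχ₀]
    have hyloc := (SelmerStructure.mem_selmerGroup_iff _ _).mp hy
    -- [unr] `Sh b` is unramified at the finite `w ∉ S₀`, `w ∤ p` (Milne I 2.6 for THE maps + the `Ψ`-transport)
    have hunr : ∀ w : HeightOneSpectrum (𝓞 ℚ), w ∉ S₀ → (p : 𝓞 ℚ) ∉ w.asIdeal →
        galoisCohomology.localization ((cofreeTorsionGaloisModule S ρ ((p ^ k : ℕ) : ℤ)).coind (κ.layerSubgroup n) (κ.isOpen_layerSubgroup n)) (Sum.inr w) 1
            (shapiroLift (cofreeTorsionGaloisModule S ρ ((p ^ k : ℕ) : ℤ)).toTopRep (κ.layerSubgroup n) (κ.isOpen_layerSubgroup n) hs hs1 b) ∈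
          unramifiedSubgroup (GaloisRep.toLocal w ((cofreeTorsionGaloisModule S ρ ((p ^ k : ℕ) : ℤ)).coind (κ.layerSubgroup n) (κ.isOpen_layerSubgroup n))) 1 := by
      intro w hwS₀ hwp
      have hw : w ∉ Sset := fun h => h.elim (fun h1 => hwS₀ (Finset.mem_coe.mp h1)) (fun h2 => hwp h2)
      have hwS : (Sum.inr w : Place ℚ) ∉ Sfin := fun h => hw ((hSinr w).mp h)
      have hne : (Sum.inr w : Place ℚ) ≠ Sum.inr v := fun h => hwS (by rw [h]; exact hv₀)
      have h1 := hyloc (Sum.inr w)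
      rw [LocalInvariants.dualSelmerStructure_apply, h𝓕ne _ hne, h𝓖nS w hw,
        (SchneiderFreeAdditiveX3.PoitouTateReduction.unramifiedOrthogonal_of_isPerfect_allLevels
          (LocalInvariants.canonical ℚ (p ^ k)) LocalInvariants.canonical_isPerfect _ hM w (hS' w hwS).1 (hS' w hwS).2).1] at h1
      exact localization_mem_unramifiedSubgroup_of_coindTateDual (cofreeTorsionGaloisModule S ρ ((p ^ k : ℕ) : ℤ)) (p ^ k) (ePk k) (hμPk k) (hadd₁Pk k) (hadd₂Pk k) (hgalPk k)
        (κ.layerSubgroup n) (κ.isOpen_layerSubgroup n) hnondeg hN w _ h1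
    -- [inf] `Sh b` is trivial at the infinite place (`⊤^⊥ = 0`, Milne I 2.13, + the `Ψ`-transport)
    have hinf : ∀ w : InfinitePlace ℚ,
        galoisCohomology.localization ((cofreeTorsionGaloisModule S ρ ((p ^ k : ℕ) : ℤ)).coind (κ.layerSubgroup n) (κ.isOpen_layerSubgroup n)) (Sum.inl w) 1
          (shapiroLift (cofreeTorsionGaloisModule S ρ ((p ^ k : ℕ) : ℤ)).toTopRep (κ.layerSubgroup n) (κ.isOpen_layerSubgroup n) hs hs1 b) = 0 := by
      intro w
      have h1 := hyloc (Sum.inl w)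
      rw [LocalInvariants.dualSelmerStructure_apply, h𝓕ne _ Sum.inl_ne_inr, h𝓖inl w,
        LocalInvariants.mem_dualLocalCondition_iff] at h1
      have h2 := eq_zero_of_forall_localTatePairingZMod_canonical_inl_eq_zero (p ^ k) _ hM w _
        fun a => h1 a (AddSubgroup.mem_top a)
      exact localization_eq_zero_of_localization_coindTateDual_eq_zero (cofreeTorsionGaloisModule S ρ ((p ^ k : ℕ) : ℤ)) (p ^ k) (ePk k) (hμPk k) (hadd₁Pk k) (hadd₂Pk k)
        (hgalPk k) (κ.layerSubgroup n) (κ.isOpen_layerSubgroup n) hnondeg hN (Sum.inl w) _ h2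
    -- [kum] the layer localisation of `b` at `v` is the Θ-Kummer class of `Q₀` (characters + non-degeneracy of the layer pairing)
    have hkum : layerLocOf (cofreeTorsionGaloisModule S ρ ((p ^ k : ℕ) : ℤ)) κ v n b = thetaLayerKummer S ρ k W Θ κ v hΘ n (Q₀ : Fin r → localLayerPointsOfEmb κ ι W n) := by
      have hsub : layerShapiroOf (cofreeTorsionGaloisModule S ρ ((p ^ k : ℕ) : ℤ)) κ v n (layerLocOf (cofreeTorsionGaloisModule S ρ ((p ^ k : ℕ) : ℤ)) κ v n b) -
          layerShapiroOf (cofreeTorsionGaloisModule S ρ ((p ^ k : ℕ) : ℤ)) κ v n (thetaLayerKummer S ρ k W Θ κ v hΘ n (Q₀ : Fin r → localLayerPointsOfEmb κ ι W n)) = 0 := by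
        refine eq_zero_of_forall_invAt_cupProduct_pull_eq_zero (cofreeTorsionGaloisModule S ρ ((p ^ k : ℕ) : ℤ)) (p ^ k) (ePk k) (hμPk k) (hadd₁Pk k) (hadd₂Pk k) (hgalPk k)
          κ v hκ hv hnondeg hN n _ fun a' => ?_
        rw [map_sub, map_sub,
          ← localTatePairingZMod_canonical_localization_coindTateDual_shapiroLift (cofreeTorsionGaloisModule S ρ ((p ^ k : ℕ) : ℤ)) (p ^ k) (ePk k) (hμPk k) (hadd₁Pk k)
            (hadd₂Pk k) (hgalPk k) κ v hκ hv n hs hs1 a' b,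
          ← hTpair, ← hQ₀]
        exact sub_self _
      rw [← map_sub] at hsub
      exact sub_eq_zero.mp (shapiroLift_injective _ _ _ _ _ (hsub.trans (map_zero _).symm))
    -- levelwise orthogonality
    exact hT b _ Q₀.2 hunr hinf hkum
  /- ### The one-place lift (Milne I 4.10 (b) for THE maps) and the output class `c = Sh⁻¹ X` -/
  obtain ⟨X, hX𝓖, hXval, -⟩ :=
    LocalInvariants.exists_selmer_canonical_localTatePairing_eq_of_subgroup
      (SchneiderFreeAdditiveX3.PoitouTateReduction.poitouTate_selmerStructure_duality_real_holds ℚ) _ hM hS' hle h𝓕 h𝓖 hv₀ h𝓖v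
      C h𝓕v' χ hχ
  obtain ⟨c, hc⟩ := shapiroLift_surjective (cofreeTorsionGaloisModule S ρ ((p ^ k : ℕ) : ℤ)).toTopRep (κ.layerSubgroup n) (κ.isOpen_layerSubgroup n) hs hs1 X
  have hXloc := (SelmerStructure.mem_selmerGroup_iff _ _).mp hX𝓖
  refine ⟨c, ?_, fun w hw => ?_, fun Q hQ => ?_⟩
  · -- [adm] (X ∈ H¹_𝓖: unramified outside `Sfin`; (E1a/d))
    refine admissible_of_forall_localization_shapiroLift_mem S ρ κ _ n hs hs1 (S' := Sset)
      (fun w hw => ⟨(hnotS w hw).2, hρ w (hnotS w hw).1 (hnotS w hw).2⟩) c fun w hw => ?_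
    have hwS : (Sum.inr w : Place ℚ) ∉ Sfin := fun h => hw ((hSinr w).mp h)
    have h1 := hXloc (Sum.inr w)
    rw [h𝓖.2 w hwS, ← hc] at h1
    exact h1
  · -- [strict] at `w ∈ S₀`: `𝓖_w = ⊥`
    have h1 := hXloc (Sum.inr w)
    rw [h𝓖S₀ w hw, ← hc] at h1
    exact (AddSubgroup.mem_bot).mp h1
  · -- [val] `⟨loc_n c, θK Q⟩_{n,p^k} = ⟨loc_v X, c_Q⟩_v = χ_z(c_Q) = (z Q) mod p^k`
    rw [layerPairingH1Of_apply, ← cohomologyMap_coindFinPull_localization_shapiroLift (cofreeTorsionGaloisModule S ρ ((p ^ k : ℕ) : ℤ)) κ v hκ hv n hs hs1 c, ← hTpair, hc]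
    exact (hXval _ ⟨⟨Q, hQ⟩, rfl⟩).trans ((hχval ⟨Q, hQ⟩).trans (hχ₀ ⟨Q, hQ⟩))


include hnondeg hκ hv hS₀ hρ in
/-- **The S4₂ form (`Pn = ⊤`, Θ-Kummer kernel discharged).** Levelwise orthogonality for ALL layer-`n` tuples ⟹ a class
`c ∈ H¹(Γ_n, A_ρ[p^k])`, admissible outside `S₀ ∪ {w ∋ p}`, dying at `S₀`, whose layer pairing with the Θ-Kummer class of EVERY layer tuple
`Q` is `(z Q) mod p^k` — stated in the `(Q, hQ)` tuple currency of `DeepHalfTransfer.exists_iwasawaH1_locd₂_eq_of_levelwise_from` (`hSol`).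
CONDITIONAL on `hT` only. [cite: MilneADT2006, Ch. I, Thm. 4.10(b)] [cite: Kobayashi2003, (7.17)–(7.21), (8.23)] -/
theorem exists_admissible_strict_valueCond_of_levelwise_orthogonal_top [CompactSpace (absoluteGaloisGroup ℚ)]
    [CompactSpace (absoluteGaloisGroup (v.adicCompletion ℚ))]
    (z : (Fin r → localTowerPointsOfEmb κ (closureEmb (K := ℚ) (v.adicCompletion ℚ)) W) →+ ℤ_[p])
    (hT : ∀ (b : H1 (cofreeTorsionGaloisModule S ρ ((p ^ k : ℕ) : ℤ)) (κ.layerSubgroup n))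
      (Q₀ : Fin r → localLayerPointsOfEmb κ (closureEmb (K := ℚ) (v.adicCompletion ℚ)) W n),
      (∀ w : HeightOneSpectrum (𝓞 ℚ), w ∉ S₀ → (p : 𝓞 ℚ) ∉ w.asIdeal →
        galoisCohomology.localization
            ((cofreeTorsionGaloisModule S ρ ((p ^ k : ℕ) : ℤ)).coind (κ.layerSubgroup n) (κ.isOpen_layerSubgroup n)) (Sum.inr w) 1
            (shapiroLift (cofreeTorsionGaloisModule S ρ ((p ^ k : ℕ) : ℤ)).toTopRep (κ.layerSubgroup n) (κ.isOpen_layerSubgroup n)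
              hs hs1 b) ∈
          unramifiedSubgroup (GaloisRep.toLocal w
            ((cofreeTorsionGaloisModule S ρ ((p ^ k : ℕ) : ℤ)).coind (κ.layerSubgroup n) (κ.isOpen_layerSubgroup n))) 1) →
      (∀ w : InfinitePlace ℚ,
        galoisCohomology.localization
            ((cofreeTorsionGaloisModule S ρ ((p ^ k : ℕ) : ℤ)).coind (κ.layerSubgroup n) (κ.isOpen_layerSubgroup n)) (Sum.inl w) 1
            (shapiroLift (cofreeTorsionGaloisModule S ρ ((p ^ k : ℕ) : ℤ)).toTopRep (κ.layerSubgroup n) (κ.isOpen_layerSubgroup n)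
              hs hs1 b) = 0) →
      layerLocOf (cofreeTorsionGaloisModule S ρ ((p ^ k : ℕ) : ℤ)) κ v n b = thetaLayerKummer S ρ k W Θ κ v hΘ n Q₀ →
      PadicInt.toZModPow k (z (fun i => ⟨(Q₀ i : localPoints W (v.adicCompletion ℚ)),
        localLayerPointsOfEmb_le_localTowerPointsOfEmb κ _ W n (Q₀ i).2⟩)) = 0) :
    ∃ c : H1 (cofreeTorsionGaloisModule S ρ ((p ^ k : ℕ) : ℤ)) (κ.layerSubgroup n),
      (∀ w : HeightOneSpectrum (𝓞 ℚ), w ∉ ((↑S₀ : Set (HeightOneSpectrum (𝓞 ℚ))) ∪ {u | (p : 𝓞 ℚ) ∈ u.asIdeal}) →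
        ∀ 𝔓 ∈ w.primesAbove,
          resLe (cofreeTorsionGaloisModule S ρ ((p ^ k : ℕ) : ℤ)).toTopRep
            (inf_le_left : κ.layerSubgroup n ⊓ 𝔓.inertia (absoluteGaloisGroup ℚ) ≤ κ.layerSubgroup n) 1 c = 0) ∧
      (∀ w ∈ S₀,
        galoisCohomology.localization
            ((cofreeTorsionGaloisModule S ρ ((p ^ k : ℕ) : ℤ)).coind (κ.layerSubgroup n) (κ.isOpen_layerSubgroup n)) (Sum.inr w) 1
            (shapiroLift (cofreeTorsionGaloisModule S ρ ((p ^ k : ℕ) : ℤ)).toTopRep (κ.layerSubgroup n) (κ.isOpen_layerSubgroup n)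
              hs hs1 c) = 0) ∧
      ∀ (Q : Fin r → localPoints W (v.adicCompletion ℚ))
        (hQ : ∀ i, Q i ∈ localLayerPointsOfEmb κ (closureEmb (K := ℚ) (v.adicCompletion ℚ)) W n),
        layerPairingH1Of (cofreeTorsionGaloisModule S ρ ((p ^ k : ℕ) : ℤ)) (p ^ k) (ePk k) (hμPk k) (hadd₁Pk k) (hadd₂Pk k) (hgalPk k)
            κ v n (layerLocOf (cofreeTorsionGaloisModule S ρ ((p ^ k : ℕ) : ℤ)) κ v n c)
            (thetaLayerKummer S ρ k W Θ κ v hΘ n (fun i => ⟨Q i, hQ i⟩)) =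
          PadicInt.toZModPow k (z (fun i => ⟨Q i, localLayerPointsOfEmb_le_localTowerPointsOfEmb κ _ W n (hQ i)⟩)) := by
  obtain ⟨c, hadm, hstrict, hval⟩ := exists_admissible_strict_valueCond_of_levelwise_orthogonal S ρ W k ePk hμPk hadd₁Pk hadd₂Pk
    hgalPk hnondeg Θ κ v hΘ hκ hv S₀ hS₀ hρ n hs hs1 ⊤ z
    (fun Q _ hQ => toZModPow_eq_zero_of_thetaLayerKummer_eq_zero S ρ k W Θ κ v hΘ n z Q hQ) (fun b Q₀ _ => hT b Q₀)
  exact ⟨c, hadm, hstrict, fun Q hQ => hval (fun i => ⟨Q i, hQ i⟩) (AddSubgroup.mem_top _)⟩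

end Levelwise

end ThetaTransport.DeepHalfLevelwise

end Summit.BirchSwinnertonDyer.BirchSwinnertonDyer.Theorems

end
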